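import Mathlib
import HarnessLib
import Summits.Ventures.LatticeQCDFlow.Scoring.KArmHomogeneityLocalPower
import Summits.Ventures.LatticeQCDFlow.Scoring.GaussianShiftedBallThreshold
import Summits.Ventures.LatticeQCDFlow.Scoring.SimultaneousAgreementIndependentColumns

/-!
# THE TABLE OF `k`-ARM TESTS UNDER LOCAL DRIFTS: `P(all J couplings pass) → ∏_j F_c(κ_j)`, WHICH IS
# AT MOST THE NOMINAL `F_c(0)^J` (WITH EQUALITY IFF EVERY `κ_j = 0`) AND AT MOST THE WINDOW OF THE MOST
# DISCREPANT COUPLING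

HONEST FRAMING: exact (Metropolis-corrected) sampling algorithms for lattice gauge theory;
figures of merit are autocorrelation/cost numbers at stated couplings and volumes; no
continuum-physics claim.

Venture `LatticeQCDFlow` (cell pub-lqcd), topic `Scoring`; FANOUT row 4 (`s0-u1-b`, GEN-35).
NEW WORK of the cell (classical; our formalisation), no definition, nothing cited as a fact.

WHY (row 4: "at every β").  `Scoring/KArmHomogeneitySidak` calibrates the table of `J` independent
`k`-arm tests under equal targets (`→ G(c)^J`).  Under the local alternatives of
`Scoring/KArmHomogeneityLocalPower` coupling `j` has its own non-centrality `κ_j`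
(`κ_j² = Σ_r (h_{j,r} − h̄_{j,w})²/s_{j,r}`) and limiting pass probability `F_c(κ_j)` (the shifted
ball).  This file records the table-level consequences: (i) the whole table passes with probability
`→ ∏_j F_c(κ_j)` (**`kArm_homogeneity_simultaneous_localPower`**, product law of
`Scoring/SimultaneousAgreementIndependentColumns`); (ii) `∏_j F_c(κ_j) ≤ F_c(0)^J`, the nominal table
level — the table test is unbiased (**`prod_shiftedBall_le_nominal_pow`**), with EQUALITY IFF every
`κ_j = 0` when `c > 0` (**`prod_shiftedBall_eq_nominal_pow_iff`**, strict decrease of `F_c`,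
`Scoring/GaussianShiftedBallThreshold`); (iii) `∏_j F_c(κ_j) ≤ F_c(κ_{j₀}) ≤ N(κ_{j₀},1)([−√c,√c])` for
every `j₀` (**`prod_shiftedBall_le_single`**, **`prod_shiftedBall_le_window`**): one sufficiently
discrepant coupling sinks the whole table, whatever the others do.

NOT CLAIMED: dependent couplings; numbers.
-/

open MeasureTheory ProbabilityTheory Filter Topology Finset

namespace Summit.Ventures.LatticeQCDFlow.Scoring

open Set

/-! ## §1 Products of shifted-ball probabilities -/

section Products

variable {n : ℕ} {ι : Type*} [Fintype ι]

/-- **The table is unbiased**: `∏_j F_c(κ_j) ≤ F_c(0)^J` (`κ_j ≥ 0`). [ours] -/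
theorem prod_shiftedBall_le_nominal_pow (κ : ι → ℝ) (hκ : ∀ j, 0 ≤ κ j) (c : ℝ) :
    ∏ j, (Measure.pi fun _ : Fin (n + 2) => gaussianReal 0 1).real
        {z : Fin (n + 2) → ℝ | (z 1 + κ j) ^ 2 + ∑ r ∈ (univ.erase 0).erase 1, z r ^ 2 ≤ c}
      ≤ ((Measure.pi fun _ : Fin (n + 2) => gaussianReal 0 1).real
        {z : Fin (n + 2) → ℝ | (z 1 + 0) ^ 2 + ∑ r ∈ (univ.erase 0).erase 1, z r ^ 2 ≤ c}) ^ Fintype.card ι := by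
  rw [← Finset.card_univ, ← Finset.prod_const]
  refine Finset.prod_le_prod (fun j _ => measureReal_nonneg) fun j _ => ?_
  exact pi_gaussianReal_shiftedBall_antitoneOn (ι := Fin (n + 2)) 0 1 c (Set.mem_Ici.2 le_rfl)
    (Set.mem_Ici.2 (hκ j)) (hκ j)

/-- **… with equality iff every coupling is drift-free** (`c > 0`, `κ_j ≥ 0`). [ours] -/
theorem prod_shiftedBall_eq_nominal_pow_iff (κ : ι → ℝ) (hκ : ∀ j, 0 ≤ κ j) {c : ℝ} (hc : 0 < c) :
    ∏ j, (Measure.pi fun _ : Fin (n + 2) => gaussianReal 0 1).real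
        {z : Fin (n + 2) → ℝ | (z 1 + κ j) ^ 2 + ∑ r ∈ (univ.erase 0).erase 1, z r ^ 2 ≤ c}
      = ((Measure.pi fun _ : Fin (n + 2) => gaussianReal 0 1).real
        {z : Fin (n + 2) → ℝ | (z 1 + 0) ^ 2 + ∑ r ∈ (univ.erase 0).erase 1, z r ^ 2 ≤ c}) ^ Fintype.card ι
      ↔ ∀ j, κ j = 0 := by
  classical
  set F : ℝ → ℝ := fun κ => (Measure.pi fun _ : Fin (n + 2) => gaussianReal 0 1).real
    {z : Fin (n + 2) → ℝ | (z 1 + κ) ^ 2 + ∑ r ∈ (univ.erase 0).erase 1, z r ^ 2 ≤ c} with hF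
  have hanti := pi_gaussianReal_shiftedBall_strictAntiOn (ι := Fin (n + 2)) 0 1 hc
  have hF0 : 0 < F 0 := by
    -- `F(0) ≥ F(1) ≥ 0` strictly above `F(1)`: use strict decrease `F 1 < F 0` and `0 ≤ F 1`
    have h1 : F 1 < F 0 := hanti (Set.mem_Ici.2 le_rfl) (Set.mem_Ici.2 zero_le_one) zero_lt_one
    exact lt_of_le_of_lt measureReal_nonneg h1
  constructor
  · intro heq
    by_contra hne
    push Not at hne
    obtain ⟨j₀, hj₀⟩ := hne
    have hlt0 : F (κ j₀) < F 0 :=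
      hanti (Set.mem_Ici.2 le_rfl) (Set.mem_Ici.2 (hκ j₀)) (lt_of_le_of_ne (hκ j₀) (Ne.symm hj₀))
    have hle : ∀ j, F (κ j) ≤ F 0 := fun j =>
      pi_gaussianReal_shiftedBall_antitoneOn (ι := Fin (n + 2)) 0 1 c (Set.mem_Ici.2 le_rfl)
        (Set.mem_Ici.2 (hκ j)) (hκ j)
    -- split off `j₀`: `∏_j F(κ_j) ≤ F(κ_{j₀}) · F(0)^{J−1} < F(0)^J`
    have hsplit : ∏ j, F (κ j) = F (κ j₀) * ∏ j ∈ univ.erase j₀, F (κ j) :=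
      (Finset.mul_prod_erase _ _ (Finset.mem_univ j₀)).symm
    have hrest : ∏ j ∈ univ.erase j₀, F (κ j) ≤ ∏ _j ∈ univ.erase j₀, F 0 :=
      Finset.prod_le_prod (fun j _ => measureReal_nonneg) fun j _ => hle j
    have hpow : ∏ _j ∈ (univ : Finset ι).erase j₀, F 0 = F 0 ^ (Fintype.card ι - 1) := by
      rw [Finset.prod_const, Finset.card_erase_of_mem (Finset.mem_univ j₀), Finset.card_univ]
    have hlt : ∏ j, F (κ j) < F 0 ^ Fintype.card ι := by
      have hcard : Fintype.card ι = (Fintype.card ι - 1) + 1 :=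
        (Nat.succ_pred_eq_of_pos (Fintype.card_pos_iff.2 ⟨j₀⟩)).symm
      calc ∏ j, F (κ j) = F (κ j₀) * ∏ j ∈ univ.erase j₀, F (κ j) := hsplit
        _ ≤ F (κ j₀) * F 0 ^ (Fintype.card ι - 1) := by
            rw [← hpow]; exact mul_le_mul_of_nonneg_left hrest measureReal_nonneg
        _ < F 0 * F 0 ^ (Fintype.card ι - 1) := mul_lt_mul_of_pos_right hlt0 (pow_pos hF0 _)
        _ = F 0 ^ Fintype.card ι := by rw [← pow_succ', ← hcard]
    exact absurd heq (ne_of_lt hlt)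
  · intro h0
    simp only [h0]
    rw [Finset.prod_const, Finset.card_univ]

/-- **One discrepant coupling sinks the table**: `∏_j F_c(κ_j) ≤ F_c(κ_{j₀})` for every `j₀`. [ours] -/
theorem prod_shiftedBall_le_single (κ : ι → ℝ) (c : ℝ) (j₀ : ι) :
    ∏ j, (Measure.pi fun _ : Fin (n + 2) => gaussianReal 0 1).real
        {z : Fin (n + 2) → ℝ | (z 1 + κ j) ^ 2 + ∑ r ∈ (univ.erase 0).erase 1, z r ^ 2 ≤ c}
      ≤ (Measure.pi fun _ : Fin (n + 2) => gaussianReal 0 1).real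
        {z : Fin (n + 2) → ℝ | (z 1 + κ j₀) ^ 2 + ∑ r ∈ (univ.erase 0).erase 1, z r ^ 2 ≤ c} := by
  classical
  rw [← Finset.mul_prod_erase _ _ (Finset.mem_univ j₀)]
  have h1 : ∏ j ∈ univ.erase j₀, (Measure.pi fun _ : Fin (n + 2) => gaussianReal 0 1).real
      {z : Fin (n + 2) → ℝ | (z 1 + κ j) ^ 2 + ∑ r ∈ (univ.erase 0).erase 1, z r ^ 2 ≤ c} ≤ 1 :=
    Finset.prod_le_one (fun j _ => measureReal_nonneg) fun j _ => measureReal_le_one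
  calc _ ≤ (Measure.pi fun _ : Fin (n + 2) => gaussianReal 0 1).real
        {z : Fin (n + 2) → ℝ | (z 1 + κ j₀) ^ 2 + ∑ r ∈ (univ.erase 0).erase 1, z r ^ 2 ≤ c} * 1 :=
        mul_le_mul_of_nonneg_left h1 measureReal_nonneg
    _ = _ := mul_one _

/-- **… and is at most the window of that coupling**: `∏_j F_c(κ_j) ≤ N(κ_{j₀},1)([−√c, √c])`
(`c ≥ 0`), which `→ 0` as `κ_{j₀} → ∞` (`Scoring/AgreementTestLocalPower`). [ours] -/
theorem prod_shiftedBall_le_window (κ : ι → ℝ) {c : ℝ} (hc : 0 ≤ c) (j₀ : ι) :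
    ∏ j, (Measure.pi fun _ : Fin (n + 2) => gaussianReal 0 1).real
        {z : Fin (n + 2) → ℝ | (z 1 + κ j) ^ 2 + ∑ r ∈ (univ.erase 0).erase 1, z r ^ 2 ≤ c}
      ≤ (gaussianReal (κ j₀) 1).real (Icc (-Real.sqrt c) (Real.sqrt c)) := by
  refine (prod_shiftedBall_le_single κ c j₀).trans ?_
  have h1 := pi_gaussianReal_shiftedBall_le_marginal (ι := Fin (n + 2)) 0 1 (κ j₀) c
  rw [gaussianReal_sqShift_le_eq hc] at h1
  simp only [measureReal_def]
  exact (ENNReal.toReal_le_toReal (measure_ne_top _ _) (measure_ne_top _ _)).2 h1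

end Products

/-! ## §2 The table of `k`-arm tests under local drifts -/

section Table

variable {n : ℕ} {ι : Type*} [Fintype ι]
variable {Ωs : ι → Fin (n + 2) → Type*} [∀ j r, MeasurableSpace (Ωs j r)]
  {Ps : (j : ι) → (r : Fin (n + 2)) → Measure (Ωs j r)} [∀ j r, IsProbabilityMeasure (Ps j r)]
variable {Ω' : Type*} [MeasurableSpace Ω'] {P' : Measure Ω'} [IsProbabilityMeasure P']

/-- **THE TABLE UNDER LOCAL DRIFTS**: at each of `J = |ι|` independent couplings, `R = n + 2` codes
with `√k(S − a_j) ⇒ N(h_{j,r}, s_{j,r})` independent and `k·V̂ → s_{j,r}` a.s.; then the probability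
that the homogeneity statistic is `≤ c` at EVERY coupling tends to `∏_j F_c(κ_j)`,
`κ_j = √(Σ_r (h_{j,r} − h̄_{j,w})²/s_{j,r})`. [ours] -/
theorem kArm_homogeneity_simultaneous_localPower
    {S V : (j : ι) → (r : Fin (n + 2)) → ℕ → Ωs j r → ℝ} {a : ι → ℝ}
    {h s : ι → Fin (n + 2) → ℝ} {Z : ι → Fin (n + 2) → Ω' → ℝ} (hs : ∀ j r, 0 < s j r)
    (hSm : ∀ j r k, Measurable (S j r k)) (hVm : ∀ j r k, Measurable (V j r k))
    (hclt : ∀ j r, TendstoInDistribution (fun (k : ℕ) ω => Real.sqrt k * (S j r k ω - a j)) atTop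
      (Z j r) (fun _ => Ps j r) P')
    (hZm : ∀ j r, Measurable (Z j r))
    (hZ : ∀ j r, HasLaw (Z j r) (gaussianReal (h j r) (s j r).toNNReal) P')
    (hind : ∀ j, iIndepFun (Z j) P')
    (hV : ∀ j r, ∀ᵐ ω ∂(Ps j r), Tendsto (fun k : ℕ => (k : ℝ) * V j r k ω) atTop (𝓝 (s j r)))
    (c : ℝ) :
    Tendsto (fun k : ℕ => (Measure.pi fun j => Measure.pi (Ps j)).real
        {ω : (j : ι) → (r : Fin (n + 2)) → Ωs j r | ∀ j,
          ∑ r, (S j r k (ω j r) - (∑ i, S j i k (ω j i) / V j i k (ω j i)) / (∑ i, (V j i k (ω j i))⁻¹)) ^ 2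
            / V j r k (ω j r) ≤ c})
      atTop (𝓝 (∏ j, (Measure.pi fun _ : Fin (n + 2) => gaussianReal 0 1).real
        {z : Fin (n + 2) → ℝ | (z 1 + Real.sqrt (∑ r, (h j r - (∑ i, h j i / s j i) / (∑ i, (s j i)⁻¹)) ^ 2
            / s j r)) ^ 2 + ∑ r ∈ (univ.erase 0).erase 1, z r ^ 2 ≤ c})) :=
  CardConsistency.tendsto_measureReal_pi_forall_mem (fun j => Measure.pi (Ps j))
    (E := fun k j => {ω : (r : Fin (n + 2)) → Ωs j r |
      ∑ r, (S j r k (ω r) - (∑ i, S j i k (ω i) / V j i k (ω i)) / (∑ i, (V j i k (ω i))⁻¹)) ^ 2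
        / V j r k (ω r) ≤ c})
    fun j => kArm_homogeneity_localPower (hs j) (hSm j) (hVm j) (hclt j) (hZm j) (hZ j) (hind j) (hV j) c

end Table


end Summit.Ventures.LatticeQCDFlow.Scoring
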